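import Mathlib

/-!
# Polytope transport — calculus of `ℚ`-polynomials in the first coordinate

Helper file for `PolytopeTransport` (stmt-KontsevichZagierPeriods-10815, route ScissorsTransport).
`ℚ`-polynomials `p : MvPolynomial (Fin n) ℚ` are evaluated at real points through `MvPolynomial.aeval`
(the language of `Literature.ModelTheory.ExponentialFields.IsSemialgebraic`). We record: smoothness of
`x ↦ aeval x p`; the formal antiderivative `antider p` in the variable `0` with
`pderiv 0 (antider p) = p`; the derivative of `t ↦ aeval (Fin.cons t y) p` is
`aeval (Fin.cons t y) (pderiv 0 p)`; substitution of a polynomial for the variable `0` (`subst0`),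
lifting of a polynomial in the tail variables (`liftPoly`), the definite integral in the variable
`0` between polynomial bounds (`defInt`) and the primitive vanishing on the lower bound
(`primZero`), with their evaluation rules and the resulting monotonicity / intermediate-value
facts. All folklore.
-/

noncomputable section

open Set MvPolynomial

namespace Summit.KontsevichZagierPeriods.ScissorsTransport.PolytopeTransport

variable {n : ℕ}

/-! ### Smoothness of polynomial functions -/

/-- Real evaluation of a `ℚ`-polynomial is a smooth function. [folklore] -/
theorem contDiff_aeval {m : WithTop ℕ∞} (p : MvPolynomial (Fin n) ℚ) :
    ContDiff ℝ m (fun x : Fin n → ℝ => aeval x p) := by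
  induction p using MvPolynomial.induction_on with
  | C a => simpa using contDiff_const
  | add p q hp hq => simpa using hp.add hq
  | mul_X p i hp => simpa using hp.mul (contDiff_apply ℝ ℝ i)

/-- Real evaluation of a `ℚ`-polynomial is continuous. [folklore] -/
theorem continuous_aeval (p : MvPolynomial (Fin n) ℚ) :
    Continuous (fun x : Fin n → ℝ => aeval x p) :=
  (contDiff_aeval (m := 0) p).continuous

/-- Real evaluation of a `ℚ`-polynomial is strictly differentiable, with derivative `fderiv`.
[folklore] -/
theorem hasStrictFDerivAt_aeval (p : MvPolynomial (Fin n) ℚ) (x : Fin n → ℝ) :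
    HasStrictFDerivAt (fun x : Fin n → ℝ => aeval x p) (fderiv ℝ (fun x : Fin n → ℝ => aeval x p) x) x :=
  (contDiff_aeval (m := 1) p).contDiffAt.hasStrictFDerivAt one_ne_zero

/-! ### Differentiation and anti-differentiation in the variable `0` -/

/-- Derivative of a polynomial along the first coordinate: `d/dt p(t, y) = (∂₀ p)(t, y)`.
[folklore] -/
theorem hasDerivAt_aeval_cons (p : MvPolynomial (Fin (n + 1)) ℚ) (y : Fin n → ℝ) (t : ℝ) :
    HasDerivAt (fun s : ℝ => aeval (Fin.cons s y : Fin (n + 1) → ℝ) p)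
      (aeval (Fin.cons t y : Fin (n + 1) → ℝ) (pderiv 0 p)) t := by
  induction p using MvPolynomial.induction_on with
  | C a => simpa using hasDerivAt_const t ((algebraMap ℚ ℝ) a)
  | add p q hp hq =>
    simp only [map_add]
    exact hp.add hq
  | mul_X p i hp =>
    simp only [map_mul, aeval_X, Derivation.leibniz, smul_eq_mul, map_add]
    refine Fin.cases ?_ (fun j => ?_) i
    · simp only [Fin.cons_zero, pderiv_X, Pi.single_eq_same, map_one, mul_one]
      exact (hp.mul (hasDerivAt_id t)).congr_deriv (by simp only [id_eq]; ring)
    · have h := hp.mul_const (y j)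
      have h0 : (Pi.single (0 : Fin (n + 1)) (1 : MvPolynomial (Fin (n + 1)) ℚ) : Fin (n + 1) →
          MvPolynomial (Fin (n + 1)) ℚ) j.succ = 0 := Pi.single_eq_of_ne (Fin.succ_ne_zero j) _
      simp only [Fin.cons_succ, pderiv_X, h0, map_zero, mul_zero, zero_add]
      exact h.congr_deriv (mul_comm _ _)

/-- The formal antiderivative of `p` in the variable `0`: `∑ c_m X^{m + e₀} / (m₀ + 1)`. [folklore] -/
def antider (p : MvPolynomial (Fin (n + 1)) ℚ) : MvPolynomial (Fin (n + 1)) ℚ :=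
  ∑ m ∈ p.support, monomial (m + Finsupp.single 0 1) (coeff m p / ((m 0 : ℚ) + 1))

/-- `∂₀ (antider p) = p`. [folklore] -/
theorem pderiv_antider (p : MvPolynomial (Fin (n + 1)) ℚ) : pderiv 0 (antider p) = p := by
  rw [antider, map_sum]
  conv_rhs => rw [p.as_sum]
  refine Finset.sum_congr rfl fun m _ => ?_
  rw [pderiv_monomial, add_tsub_cancel_right]
  congr 1
  have h : ((m 0 : ℚ) + 1) ≠ 0 := Nat.cast_add_one_ne_zero (m 0)
  simp only [Finsupp.coe_add, Pi.add_apply, Finsupp.single_eq_same, Nat.cast_add, Nat.cast_one]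
  exact div_mul_cancel₀ _ h

/-- Derivative of the antiderivative along the first coordinate: `d/dt (antider p)(t, y) = p(t, y)`.
[folklore] -/
theorem hasDerivAt_aeval_antider (p : MvPolynomial (Fin (n + 1)) ℚ) (y : Fin n → ℝ) (t : ℝ) :
    HasDerivAt (fun s : ℝ => aeval (Fin.cons s y : Fin (n + 1) → ℝ) (antider p))
      (aeval (Fin.cons t y : Fin (n + 1) → ℝ) p) t := by
  simpa [pderiv_antider] using hasDerivAt_aeval_cons (antider p) y t

/-! ### Substitution for the variable `0` and lifting of tail polynomials -/

/-- Substitute the tail polynomial `a` for the variable `0`: `(subst0 a p)(y) = p(a y, y)`.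
[folklore] -/
def subst0 (a : MvPolynomial (Fin n) ℚ) (p : MvPolynomial (Fin (n + 1)) ℚ) : MvPolynomial (Fin n) ℚ :=
  bind₁ (Fin.cons a (fun i => X i) : Fin (n + 1) → MvPolynomial (Fin n) ℚ) p

/-- Evaluation of `subst0`. [folklore] -/
@[simp] theorem aeval_subst0 (a : MvPolynomial (Fin n) ℚ) (p : MvPolynomial (Fin (n + 1)) ℚ)
    (y : Fin n → ℝ) :
    aeval y (subst0 a p) = aeval (Fin.cons (aeval y a) y : Fin (n + 1) → ℝ) p := by
  rw [subst0, aeval_bind₁]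
  congr 1
  ext i
  refine Fin.cases ?_ (fun j => ?_) i
  · simp
  · simp

/-- Lift a polynomial in the tail variables to all variables: `(liftPoly q)(x) = q(tail x)`.
[folklore] -/
def liftPoly (q : MvPolynomial (Fin n) ℚ) : MvPolynomial (Fin (n + 1)) ℚ := rename Fin.succ q

/-- Evaluation of `liftPoly`. [folklore] -/
@[simp] theorem aeval_liftPoly (q : MvPolynomial (Fin n) ℚ) (x : Fin (n + 1) → ℝ) :
    aeval x (liftPoly q) = aeval (Fin.tail x) q := by
  rw [liftPoly, aeval_rename]
  rfl

/-- The definite integral of `w` in the variable `0` between the tail polynomials `a` and `b`: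
`(defInt w a b)(y) = ∫_{a y}^{b y} w(t, y) dt`, as a polynomial. [folklore] -/
def defInt (w : MvPolynomial (Fin (n + 1)) ℚ) (a b : MvPolynomial (Fin n) ℚ) : MvPolynomial (Fin n) ℚ :=
  subst0 b (antider w) - subst0 a (antider w)

/-- The primitive of `w` in the variable `0` vanishing on `{x₀ = a(tail x)}`:
`(primZero w a)(t, y) = ∫_{a y}^{t} w(s, y) ds`, as a polynomial. [folklore] -/
def primZero (w : MvPolynomial (Fin (n + 1)) ℚ) (a : MvPolynomial (Fin n) ℚ) :
    MvPolynomial (Fin (n + 1)) ℚ :=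
  antider w - liftPoly (subst0 a (antider w))

/-- `primZero w a` along the first coordinate has derivative `w`. [folklore] -/
theorem hasDerivAt_aeval_primZero (w : MvPolynomial (Fin (n + 1)) ℚ) (a : MvPolynomial (Fin n) ℚ)
    (y : Fin n → ℝ) (t : ℝ) :
    HasDerivAt (fun s : ℝ => aeval (Fin.cons s y : Fin (n + 1) → ℝ) (primZero w a))
      (aeval (Fin.cons t y : Fin (n + 1) → ℝ) w) t := by
  have h := (hasDerivAt_aeval_antider w y t).sub_const (aeval y (subst0 a (antider w)))
  simpa [primZero] using h

/-- `primZero w a` vanishes on the lower bound. [folklore] -/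
theorem aeval_primZero_lower (w : MvPolynomial (Fin (n + 1)) ℚ) (a : MvPolynomial (Fin n) ℚ)
    (y : Fin n → ℝ) : aeval (Fin.cons (aeval y a) y : Fin (n + 1) → ℝ) (primZero w a) = 0 := by
  simp [primZero]

/-- `primZero w a` on the upper bound is the definite integral. [folklore] -/
theorem aeval_primZero_upper (w : MvPolynomial (Fin (n + 1)) ℚ) (a b : MvPolynomial (Fin n) ℚ)
    (y : Fin n → ℝ) :
    aeval (Fin.cons (aeval y b) y : Fin (n + 1) → ℝ) (primZero w a) = aeval y (defInt w a b) := by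
  simp [primZero, defInt]

/-- `primZero w a` along the first coordinate is continuous. [folklore] -/
theorem continuous_aeval_cons (p : MvPolynomial (Fin (n + 1)) ℚ) (y : Fin n → ℝ) :
    Continuous (fun s : ℝ => aeval (Fin.cons s y : Fin (n + 1) → ℝ) p) :=
  (continuous_aeval p).comp ((Continuous.finCons continuous_id continuous_const : Continuous fun s : ℝ => (Fin.cons s y : Fin (n + 1) → ℝ)))

/-! ### Monotonicity and intermediate values of the primitive -/

section FTC

variable (w : MvPolynomial (Fin (n + 1)) ℚ) (a b : MvPolynomial (Fin n) ℚ) (y : Fin n → ℝ)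

/-- If `w > 0` on the open fibre `(a y, b y)`, the primitive `t ↦ (primZero w a)(t, y)` is strictly
increasing on `[a y, b y]`. [folklore] -/
theorem strictMonoOn_primZero
    (hw : ∀ t ∈ Ioo (aeval y a) (aeval y b), 0 < aeval (Fin.cons t y : Fin (n + 1) → ℝ) w) :
    StrictMonoOn (fun t : ℝ => aeval (Fin.cons t y : Fin (n + 1) → ℝ) (primZero w a))
      (Icc (aeval y a) (aeval y b)) := by
  refine strictMonoOn_of_deriv_pos (convex_Icc _ _) (continuous_aeval_cons _ y).continuousOn ?_
  intro t ht
  rw [interior_Icc] at ht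
  rw [(hasDerivAt_aeval_primZero w a y t).deriv]
  exact hw t ht

/-- If `w > 0` on the non-empty open fibre `(a y, b y)`, the definite integral `(defInt w a b)(y)`
is positive. [folklore] -/
theorem defInt_pos (hab : aeval y a < aeval y b)
    (hw : ∀ t ∈ Ioo (aeval y a) (aeval y b), 0 < aeval (Fin.cons t y : Fin (n + 1) → ℝ) w) :
    0 < aeval y (defInt w a b) := by
  have h := strictMonoOn_primZero w a b y hw (left_mem_Icc.2 hab.le) (right_mem_Icc.2 hab.le) hab
  simp only at h
  rwa [aeval_primZero_lower, aeval_primZero_upper] at h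

/-- On the open fibre the primitive takes values in `(0, defInt)`. [folklore] -/
theorem aeval_primZero_mem_Ioo (hab : aeval y a < aeval y b)
    (hw : ∀ t ∈ Ioo (aeval y a) (aeval y b), 0 < aeval (Fin.cons t y : Fin (n + 1) → ℝ) w)
    {t : ℝ} (ht : t ∈ Ioo (aeval y a) (aeval y b)) :
    aeval (Fin.cons t y : Fin (n + 1) → ℝ) (primZero w a) ∈ Ioo 0 (aeval y (defInt w a b)) := by
  have hmono := strictMonoOn_primZero w a b y hw
  constructor
  · have h := hmono (left_mem_Icc.2 hab.le) (Ioo_subset_Icc_self ht) ht.1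
    simp only at h
    rwa [aeval_primZero_lower] at h
  · have h := hmono (Ioo_subset_Icc_self ht) (right_mem_Icc.2 hab.le) ht.2
    simp only at h
    rwa [aeval_primZero_upper] at h

/-- Every value in `(0, defInt)` is attained by the primitive on the open fibre (intermediate value
theorem). [folklore] -/
theorem exists_aeval_primZero_eq (hab : aeval y a < aeval y b) {v : ℝ}
    (hv : v ∈ Ioo 0 (aeval y (defInt w a b))) :
    ∃ t ∈ Ioo (aeval y a) (aeval y b), aeval (Fin.cons t y : Fin (n + 1) → ℝ) (primZero w a) = v := by
  have h := intermediate_value_Ioo hab.le (continuous_aeval_cons (primZero w a) y).continuousOn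
  rw [aeval_primZero_lower, aeval_primZero_upper] at h
  exact h hv

/-- The primitive is injective on the open fibre. [folklore] -/
theorem injOn_aeval_primZero
    (hw : ∀ t ∈ Ioo (aeval y a) (aeval y b), 0 < aeval (Fin.cons t y : Fin (n + 1) → ℝ) w) :
    InjOn (fun t : ℝ => aeval (Fin.cons t y : Fin (n + 1) → ℝ) (primZero w a))
      (Ioo (aeval y a) (aeval y b)) :=
  ((strictMonoOn_primZero w a b y hw).injOn).mono Ioo_subset_Icc_self

end FTC

end Summit.KontsevichZagierPeriods.ScissorsTransport.PolytopeTransport
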